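import Mathlib
import Literature.Combinatorics.Optimization.LPRelaxationsMaxCSP
import Literature.Combinatorics.Optimization.MaxCutCspHardness
import Literature.Computability.Complexity.BooleanFourier
import HarnessLib

/-!
# Sherali–Adams solutions from consistent local distributions (de la Vega–Kenyon-Mathieu /
# Charikar–Makarychev–Makarychev, Lemma 2.1), in the pseudoexpectation currency of the tree

[topic Combinatorics/Optimization]

First file of the formalisation of the Charikar–Makarychev–Makarychev Sherali–Adams gap for
MAX-CUT ([CharikarMakarychevMakarychev2009], STOC 2009, Thm 5.3; the tree's named fact
`CharikarMakarychevMakarychev2009_maxCutSA` of `MaxCutLpLowerBound.lean`).  The printed proofs of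
all Sherali–Adams gaps in that paper produce, for every small set `T` of variables, a probability
distribution `D_T` on integer solutions of `T` such that the distributions agree on intersections;
Lemma 2.1 (p. 4–5, "implicitly used by de la Vega and Kenyon-Mathieu [6]") turns such a family into a
point of the `r`-round Sherali–Adams polytope:

> **Lemma 2.1.** "Consider a set `X`. Suppose that for every subset `T` of size at most `k = 2r + 3`,
> we are given a distribution of cuts `D_T` on `T` (i.e. distribution of subsets of `T`). Moreover,
> suppose that for two sets `Q ⊂ T`, the distributions `D_Q` and `D_T` agree in the following sense,
> for every `A ⊂ Q`: `D_Q({A}) = D_T({B : B ∩ Q = A})`. Then the vector `(x_ij)` defined by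
> `x_ij = Pr(D_{ij} separates i and j)` lies in the Sherali–Adams relaxation of the cut polytope
> (with `r` rounds of lift-and-project)."

The tree's Sherali–Adams currency is Kothari–Meka–Raghavendra's (Def. 3.3, `SAPseudoexpectation n d`
of `LPRelaxationsMaxCSP.lean`: a linear functional `Ẽ` on all real functions on `{0,1}ⁿ`, nonnegative
on nonnegative `d`-juntas, `Ẽ 1 = 1`; `SAAchieves P d c s`), which is the form in which KMR restate and
consume the CMM gap (KMR Thm 7.4, footnote: "their proofs actually show this stronger statement").  In
this currency Lemma 2.1 reads: **a consistent family of local distributions on all `T` with `|T| ≤ d`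
IS a degree-`d` pseudoexpectation** — the content of this file:

* `LocalExpectations n d` — the data of the lemma: for every `T ⊆ [n]` a positive normalised linear
  functional `L_T` on functions of the local assignments `{0,1}^T` (= a probability distribution `D_T`
  on `{0,1}^T`, `L_T F = E_{D_T} F`), consistent under restriction `{0,1}^T → {0,1}^Q` for `Q ⊆ T`
  (only the `T` with `|T| ≤ d` are constrained).
* `LocalExpectations.coeff S = L_S(χ_S)` and the degree-`d` signed pseudo-density through its Walsh
  expansion: `Ẽ f = Σ_{|S| ≤ d} L_S(χ_S) · f̂(S)` (`LocalExpectations.saE`), a linear functional on ALL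
  functions (the printed `y_I`-vector is its moment sequence).
* **`LocalExpectations.saE_eq_of_dependsOn`** — for a `T`-junta `f` (`|T| ≤ d`), `Ẽ f = L_T (f|_T)`:
  Walsh inversion on `{0,1}ⁿ` (`sum_cubeFourierCoeff_mul_walsh`), vanishing of the coefficients of a
  junta off `T` (`cubeFourierCoeff_piecewise_eq_zero`), and consistency `L_T(χ_S) = L_S(χ_S)` for `S ⊆ T`.
* **`LocalExpectations.toSA : SAPseudoexpectation n d`** (Lemma 2.1 in KMR currency).
* The MAX-CUT instance of a nonempty set `E` of edges on `[n]` (`maxCutInstance`, REUSING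
  `cutConstraint` of `MaxCutCspHardness.lean`), its value `= (#edges cut)/|E|` (`maxCutInstance_val`),
  and the gap form consumed downstream: **`not_SAAchieves_maxCut_of_localExpectations`** — if every cut
  of `E` cuts at most `s|E|` edges and `Ẽ` gives the cut indicators of the edges total value `> c|E|`,
  then the degree-`d` Sherali–Adams relaxation does not achieve a `(c,s)`-approximation for MAX-CUT on
  `n` vertices (`¬ SAAchieves maxCutPreds d c s`).

Everything is proved (finite sums); no named facts.  Rendering decisions: (i) KMR pseudoexpectations
instead of the lifted `y_I`-polytope of CMM §2 (the transfer is KMR's footnote to Thm 7.4, the warrant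
recorded in `MaxCutLpLowerBound.lean`); consequently the degree is the set size `d` itself, not
`2r + 3` vs `r` rounds; (ii) local distributions are carried as positive normalised functionals (on a
finite set the same thing as probability vectors), which is the form produced by integration against
the Gaussian measures of the companion file `GaussianSignRounding.lean` (CMM Thm 3.1).

## References

* [CharikarMakarychevMakarychev2009] M. Charikar, K. Makarychev, Y. Makarychev, *Integrality gaps for
  Sherali–Adams relaxations*, STOC 2009, 283–292, doi:10.1145/1536414.1536455; Lemma 2.1 (p. 4–5),
  §5 (p. 8–11).  Held text `paper:doi-10-1145-1536414-1536455`.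
* [delaVegaKenyonMathieu2007] W. Fernandez de la Vega, C. Kenyon-Mathieu, *Linear programming
  relaxations of maxcut*, SODA 2007, 53–61 (the origin of Lemma 2.1, as cited by CMM).
* [KothariMekaRaghavendra2017] P. Kothari, R. Meka, P. Raghavendra, *Approximating rectangles by
  juntas and weakly-exponential lower bounds for LP relaxations of CSPs*, STOC 2017 / SICOMP 2022,
  Def. 3.3 (p. 9), Thm 7.4 (p. 20).
* [ODonnell2014] R. O'Donnell, *Analysis of Boolean Functions*, CUP 2014, §1.2–1.4, §3.3 (Walsh
  expansion; the tree's `BooleanFourier.lean`).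
-/

noncomputable section

open Finset
open Literature.Probability.RandomGraphs.LowDegree (walsh sgn)
open Literature.Computability.Complexity.LowDegree (cubeFourierCoeff sum_cubeFourierCoeff_mul_walsh
  cubeFourierCoeff_piecewise_eq_zero)

namespace Literature.Combinatorics.Optimization

variable {n d : ℕ}

/-! ### Consistent local distributions, as positive normalised functionals -/

/-- **Consistent local distributions up to level `d`** (the hypothesis of CMM Lemma 2.1, p. 4–5), one
for every `T ⊆ [n]`, carried as the expectation functionals `L_T : ({0,1}^T → ℝ) → ℝ` of the
distributions `D_T`: linear, nonnegative on nonnegative functions, `L_T 1 = 1`, and CONSISTENT —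
for `Q ⊆ T` the push-forward of `D_T` under restriction `{0,1}^T → {0,1}^Q` is `D_Q`
("`D_Q({A}) = D_T({B : B ∩ Q = A})`").  Only the sets with `|T| ≤ d` are constrained (the functionals
at larger sets are ignored). [cite: CharikarMakarychevMakarychev2009, Lemma 2.1 (p. 4–5)] -/
structure LocalExpectations (n d : ℕ) where
  /-- the expectation functional of the local distribution on `{0,1}^T` -/
  L : (T : Finset (Fin n)) → (((↥T → Bool) → ℝ) →ₗ[ℝ] ℝ)
  nonneg : ∀ T : Finset (Fin n), T.card ≤ d → ∀ F : (↥T → Bool) → ℝ, (∀ b, 0 ≤ F b) → 0 ≤ L T F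
  map_one : ∀ T : Finset (Fin n), T.card ≤ d → L T (fun _ => 1) = 1
  consistent : ∀ ⦃Q T : Finset (Fin n)⦄ (h : Q ⊆ T), T.card ≤ d →
    ∀ F : (↥Q → Bool) → ℝ, L T (fun b => F (Finset.restrict₂ (π := fun _ => Bool) h b)) = L Q F

namespace LocalExpectations

variable (ℒ : LocalExpectations n d)

/-- Monotonicity of a local expectation: `F ≤ G ⇒ L_T F ≤ L_T G` (the `D_T` are probability
distributions). [cite: CharikarMakarychevMakarychev2009, Lemma 2.1 (p. 4–5)] -/
theorem mono {T : Finset (Fin n)} (hT : T.card ≤ d) {F G : (↥T → Bool) → ℝ} (h : ∀ b, F b ≤ G b) :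
    ℒ.L T F ≤ ℒ.L T G := by
  have := ℒ.nonneg T hT (G - F) fun b => by simpa using sub_nonneg.2 (h b)
  rwa [map_sub, sub_nonneg] at this

/-- A local expectation of a function bounded by `1` is at most `1`. [cite: CharikarMakarychevMakarychev2009, Lemma 2.1 (p. 4–5)] -/
theorem le_one {T : Finset (Fin n)} (hT : T.card ≤ d) {F : (↥T → Bool) → ℝ} (h : ∀ b, F b ≤ 1) :
    ℒ.L T F ≤ 1 := by
  simpa [ℒ.map_one T hT] using ℒ.mono hT (G := fun _ => 1) h

/-- The sign character `χ(b) = ∏_{i ∈ S} (−1)^{b_i}` on the local cube `{0,1}^S`. [cite: ODonnell2014, §1.2] -/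
def signProd (S : Finset (Fin n)) (b : ↥S → Bool) : ℝ := ∏ i, sgn (b i)

/-- The Walsh moments of the family: `c(S) = L_S(χ_S) = E_{D_S} ∏_{i∈S} (−1)^{x_i}`.
[cite: CharikarMakarychevMakarychev2009, Lemma 2.1 (p. 4–5)] -/
def coeff (S : Finset (Fin n)) : ℝ := ℒ.L S (signProd S)

/-- **The Sherali–Adams functional of a consistent family** (Lemma 2.1 in KMR currency):
`Ẽ f = Σ_{|S| ≤ d} c(S) f̂(S)` — integration of `f` against the degree-`d` signed pseudo-density
`Σ_{|S| ≤ d} c(S) χ_S`. [cite: CharikarMakarychevMakarychev2009, Lemma 2.1 (p. 4–5)]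
[cite: KothariMekaRaghavendra2017, Def. 3.3 (p. 9)] -/
def saE : ((Fin n → Bool) → ℝ) →ₗ[ℝ] ℝ where
  toFun f := ∑ S ∈ univ.filter (fun S : Finset (Fin n) => S.card ≤ d), ℒ.coeff S * cubeFourierCoeff f S
  map_add' f g := by
    rw [← sum_add_distrib]
    refine sum_congr rfl fun S _ => ?_
    simp only [cubeFourierCoeff, Pi.add_apply, add_mul, sum_add_distrib, add_div, mul_add]
  map_smul' a f := by
    rw [RingHom.id_apply, smul_eq_mul, mul_sum]
    refine sum_congr rfl fun S _ => ?_
    simp only [cubeFourierCoeff, Pi.smul_apply, smul_eq_mul, mul_assoc, ← mul_sum, mul_div_assoc]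
    ring

/-- Unfolding `saE`. [cite: CharikarMakarychevMakarychev2009, Lemma 2.1 (p. 4–5)] -/
theorem saE_apply (f : (Fin n → Bool) → ℝ) :
    ℒ.saE f = ∑ S ∈ univ.filter (fun S : Finset (Fin n) => S.card ≤ d),
      ℒ.coeff S * cubeFourierCoeff f S := rfl

/-- The canonical extension of a local assignment `b ∈ {0,1}^T` to `{0,1}ⁿ` (zero off `T`). [cite: ODonnell2014, §3.3 (restrictions)] -/
def extend (T : Finset (Fin n)) (b : ↥T → Bool) : Fin n → Bool :=
  fun i => if h : i ∈ T then b ⟨i, h⟩ else false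

/-- On `T` the extension is `b`. [cite: ODonnell2014, §3.3 (restrictions)] -/
@[simp] theorem extend_apply_mem (T : Finset (Fin n)) (b : ↥T → Bool) (i : ↥T) :
    extend T b i = b i := by
  simp [extend, i.2]

/-- A `T`-junta is the restriction of itself: `f x = f (extend (x|_T))`. [cite: ODonnell2014, §3.3 (restrictions)] -/
theorem eq_extend_restrict_of_dependsOn {T : Finset (Fin n)} {f : (Fin n → Bool) → ℝ}
    (hf : ∀ x y : Fin n → Bool, (∀ i ∈ T, x i = y i) → f x = f y) (x : Fin n → Bool) :
    f x = f (extend T (T.restrict x)) :=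
  hf _ _ fun i hi => by simp [extend, hi]

/-- The Walsh coefficients of a `T`-junta vanish off the subsets of `T`. [cite: ODonnell2014, Prop. 3.21] -/
theorem cubeFourierCoeff_eq_zero_of_dependsOn {T : Finset (Fin n)} {f : (Fin n → Bool) → ℝ}
    (hf : ∀ x y : Fin n → Bool, (∀ i ∈ T, x i = y i) → f x = f y) {S : Finset (Fin n)}
    (hS : ¬ S ⊆ T) : cubeFourierCoeff f S = 0 := by
  classical
  -- `f` is the restriction of itself fixing the coordinates OFF `T`
  obtain ⟨i, hiS, hiT⟩ := not_subset.1 hS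
  have hfix : f = fun x => f ((univ \ T).piecewise (fun _ => false) x) := by
    funext x
    refine hf _ _ fun j hj => ?_
    rw [Finset.piecewise_eq_of_notMem]
    simp [hj]
  rw [hfix]
  exact cubeFourierCoeff_piecewise_eq_zero f (univ \ T) (fun _ => false) ⟨i, hiS, by simp [hiT]⟩

/-- For `S ⊆ T`, the character `χ_S` at an extended local assignment is the local character of the
restriction: `χ_S(extend b) = χ_S(b|_S)`. [cite: ODonnell2014, §3.3 (restrictions)] -/
theorem walsh_extend_eq_signProd {S T : Finset (Fin n)} (h : S ⊆ T) (b : ↥T → Bool) :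
    walsh S (extend T b) = signProd S (Finset.restrict₂ (π := fun _ => Bool) h b) := by
  unfold walsh signProd
  rw [← Finset.prod_coe_sort S]
  refine Finset.prod_congr rfl fun i _ => ?_
  have hi : (i : Fin n) ∈ T := h i.2
  simp [extend, hi]

/-- Consistency on characters: `L_T(χ_S ∘ restrict) = c(S)` for `S ⊆ T`, `|T| ≤ d`.
[cite: CharikarMakarychevMakarychev2009, Lemma 2.1 (p. 4–5)] -/
theorem L_walsh_extend {S T : Finset (Fin n)} (h : S ⊆ T) (hT : T.card ≤ d) :
    ℒ.L T (fun b => walsh S (extend T b)) = ℒ.coeff S := by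
  simp_rw [walsh_extend_eq_signProd h]
  exact ℒ.consistent h hT (signProd S)

/-- **Lemma 2.1, the key identity: on a `T`-junta (`|T| ≤ d`) the Sherali–Adams functional is the
local expectation**, `Ẽ f = L_T(f|_T) = E_{D_T} f`.  Proof: both sides equal `Σ_{S ⊆ T} c(S) f̂(S)` —
the left because `f̂` vanishes off the subsets of `T`, the right by Walsh inversion inside `L_T` and
consistency on characters. [cite: CharikarMakarychevMakarychev2009, Lemma 2.1 (p. 4–5) and its proof (appendix)] -/
theorem saE_eq_of_dependsOn {T : Finset (Fin n)} (hT : T.card ≤ d) {f : (Fin n → Bool) → ℝ}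
    (hf : ∀ x y : Fin n → Bool, (∀ i ∈ T, x i = y i) → f x = f y) :
    ℒ.saE f = ℒ.L T (fun b => f (extend T b)) := by
  classical
  -- left side: restrict the sum to the subsets of `T`
  have hL : ℒ.saE f = ∑ S ∈ T.powerset, ℒ.coeff S * cubeFourierCoeff f S := by
    rw [saE_apply]
    symm
    refine Finset.sum_subset_zero_on_sdiff ?_ ?_ fun _ _ => rfl
    · intro S hS
      exact mem_filter.2 ⟨mem_univ _, (card_le_card (mem_powerset.1 hS)).trans hT⟩
    · intro S hS
      rw [mem_sdiff, mem_powerset] at hS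
      rw [cubeFourierCoeff_eq_zero_of_dependsOn hf hS.2, mul_zero]
  -- right side: Walsh inversion inside `L_T`
  have hR : (fun b : ↥T → Bool => f (extend T b)) =
      ∑ S : Finset (Fin n), fun b => cubeFourierCoeff f S * walsh S (extend T b) := by
    funext b
    rw [Finset.sum_apply]
    exact (sum_cubeFourierCoeff_mul_walsh f _).symm
  rw [hL, hR, map_sum]
  have hterm : ∀ S : Finset (Fin n),
      ℒ.L T (fun b => cubeFourierCoeff f S * walsh S (extend T b)) =
        cubeFourierCoeff f S * ℒ.L T (fun b => walsh S (extend T b)) := fun S => by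
    rw [show (fun b : ↥T → Bool => cubeFourierCoeff f S * walsh S (extend T b)) =
        cubeFourierCoeff f S • fun b => walsh S (extend T b) from rfl, map_smul, smul_eq_mul]
  simp_rw [hterm]
  refine Finset.sum_subset_zero_on_sdiff (subset_univ _) ?_ ?_
  · intro S hS
    rw [mem_sdiff, mem_powerset] at hS
    rw [cubeFourierCoeff_eq_zero_of_dependsOn hf hS.2, zero_mul]
  · intro S hS
    rw [ℒ.L_walsh_extend (mem_powerset.1 hS) hT, mul_comm]

/-- **CMM Lemma 2.1 / de la Vega–Kenyon-Mathieu, in Kothari–Meka–Raghavendra's currency: a consistent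
family of local distributions on the sets of size `≤ d` is a degree-`d` Sherali–Adams
pseudoexpectation** (nonnegative on nonnegative `d`-juntas, `Ẽ 1 = 1`).
[cite: CharikarMakarychevMakarychev2009, Lemma 2.1 (p. 4–5)] [cite: KothariMekaRaghavendra2017, Def. 3.3 (p. 9)] -/
def toSA : SAPseudoexpectation n d where
  E := ℒ.saE
  nonneg p hp hp0 := by
    obtain ⟨T, hT, hdep⟩ := hp
    rw [ℒ.saE_eq_of_dependsOn hT hdep]
    exact ℒ.nonneg T hT _ fun b => hp0 _
  map_one := by
    rw [ℒ.saE_eq_of_dependsOn (T := ∅) (by simp) (f := fun _ => (1 : ℝ)) fun _ _ _ => rfl]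
    exact ℒ.map_one ∅ (by simp)

/-- The functional of `toSA` is `saE`. [cite: CharikarMakarychevMakarychev2009, Lemma 2.1 (p. 4–5)] -/
@[simp] theorem toSA_E : ℒ.toSA.E = ℒ.saE := rfl

end LocalExpectations

/-! ### The MAX-CUT instance of a set of edges -/

/-- "`x` cuts the edge `e = {a,b}`": `x_a ≠ x_b`. [cite: CharikarMakarychevMakarychev2009, §5 (p. 8: "an α fraction of all edges crosses the cut")] -/
def IsCutBy (x : Fin n → Bool) : Sym2 (Fin n) → Bool :=
  Sym2.lift ⟨fun a b => x a != x b, fun a b => by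
    show (x a != x b) = (x b != x a)
    cases x a <;> cases x b <;> rfl⟩

/-- Unfolding `IsCutBy` on a pair. [cite: CharikarMakarychevMakarychev2009, §5 (p. 8)] -/
@[simp] theorem isCutBy_mk (x : Fin n → Bool) (a b : Fin n) : IsCutBy x s(a, b) = (x a != x b) := rfl

/-- The cut indicator `𝟙[x cuts e]` as a real function on `{0,1}ⁿ`. [cite: CharikarMakarychevMakarychev2009, §5 (p. 8)] -/
def cutFn (e : Sym2 (Fin n)) (x : Fin n → Bool) : ℝ := if IsCutBy x e then 1 else 0

/-- `𝟙[x cuts e] ≥ 0` ("the value of MAX CUT is `α ∈ [0, 1]`"). [cite: CharikarMakarychevMakarychev2009, §5 (p. 8)] -/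
theorem cutFn_nonneg (e : Sym2 (Fin n)) (x : Fin n → Bool) : 0 ≤ cutFn e x := by
  unfold cutFn; split_ifs <;> norm_num

/-- `𝟙[x cuts e] ≤ 1` ("the value of MAX CUT is `α ∈ [0, 1]`"). [cite: CharikarMakarychevMakarychev2009, §5 (p. 8)] -/
theorem cutFn_le_one (e : Sym2 (Fin n)) (x : Fin n → Bool) : cutFn e x ≤ 1 := by
  unfold cutFn; split_ifs <;> norm_num

/-- The cut indicator of `{a,b}` depends only on the coordinates `a, b` (a `2`-junta). [cite: CharikarMakarychevMakarychev2009, §5 (p. 8)] -/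
theorem cutFn_dependsOn (a b : Fin n) (x y : Fin n → Bool) (h : ∀ i ∈ ({a, b} : Finset (Fin n)), x i = y i) :
    cutFn s(a, b) x = cutFn s(a, b) y := by
  simp [cutFn, h a (by simp), h b (by simp)]

/-- An ordered representative `(a, b)`, `a ≠ b`, of a non-diagonal unordered pair. [folklore] -/
private theorem exists_eq_mk_of_not_isDiag {e : Sym2 (Fin n)} (he : ¬ e.IsDiag) :
    ∃ a b : Fin n, a ≠ b ∧ e = s(a, b) := by
  induction e using Sym2.ind with
  | h a b => exact ⟨a, b, by simpa using he, rfl⟩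

/-- **The MAX-CUT instance of a nonempty finite set `E` of edges on `[n]`** (no loops): one
inequality constraint `x_a ≠ x_b` per edge `{a,b} ∈ E` (the constraint `cutConstraint` of
`MaxCutCspHardness.lean`), enumerated by `E.equivFin`. [cite: CharikarMakarychevMakarychev2009, §5 (p. 10, "The LP relaxation for MAX CUT")]
[cite: LeeRaghavendraSteurer2015, §1.2 (p. 6)] -/
def maxCutInstance (E : Finset (Sym2 (Fin n))) (hE : E.Nonempty) (hloop : ∀ e ∈ E, ¬ e.IsDiag) :
    CSPInstance 2 n maxCutPreds where
  M := E.card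
  M_pos := card_pos.2 hE
  cons i :=
    let e : ↥E := E.equivFin.symm i
    cutConstraint (exists_eq_mk_of_not_isDiag (hloop e.1 e.2)).choose
      (exists_eq_mk_of_not_isDiag (hloop e.1 e.2)).choose_spec.choose
      (exists_eq_mk_of_not_isDiag (hloop e.1 e.2)).choose_spec.choose_spec.1

/-- The `i`-th constraint of the MAX-CUT instance is satisfied iff `x` cuts the `i`-th edge. [cite: CharikarMakarychevMakarychev2009, §5 (p. 10)] -/
theorem maxCutInstance_sat (E : Finset (Sym2 (Fin n))) (hE : E.Nonempty) (hloop : ∀ e ∈ E, ¬ e.IsDiag)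
    (i : Fin E.card) (x : Fin n → Bool) :
    ((maxCutInstance E hE hloop).cons i).sat x = IsCutBy x (E.equivFin.symm i).1 := by
  have key : ∀ (e : Sym2 (Fin n)) (a b : Fin n) (h : a ≠ b), e = s(a, b) →
      (cutConstraint a b h).sat x = IsCutBy x e := by
    rintro e a b h rfl
    rfl
  have H := exists_eq_mk_of_not_isDiag (hloop (E.equivFin.symm i).1 (E.equivFin.symm i).2)
  exact key _ _ _ H.choose_spec.choose_spec.1 H.choose_spec.choose_spec.2

/-- **The value of the MAX-CUT instance is the fraction of edges cut**:
`ℑ_E(x) = (1/|E|) Σ_{e ∈ E} 𝟙[x cuts e]`. [cite: CharikarMakarychevMakarychev2009, §5 (p. 8)] -/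
theorem maxCutInstance_val (E : Finset (Sym2 (Fin n))) (hE : E.Nonempty) (hloop : ∀ e ∈ E, ¬ e.IsDiag)
    (x : Fin n → Bool) :
    (maxCutInstance E hE hloop).val x = (∑ e ∈ E, cutFn e x) / E.card := by
  unfold CSPInstance.val
  simp_rw [maxCutInstance_sat]
  congr 1
  rw [← sum_coe_sort E]
  exact E.equivFin.symm.sum_comp (fun e : ↥E => cutFn e.1 x)

/-- The value function of the MAX-CUT instance, as a function: `ℑ_E = (1/|E|) Σ_e cutFn e`. [cite: CharikarMakarychevMakarychev2009, §5 (p. 8)] -/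
theorem maxCutInstance_val_eq (E : Finset (Sym2 (Fin n))) (hE : E.Nonempty) (hloop : ∀ e ∈ E, ¬ e.IsDiag) :
    (maxCutInstance E hE hloop).val = (E.card : ℝ)⁻¹ • ∑ e ∈ E, cutFn e := by
  funext x
  rw [maxCutInstance_val, Pi.smul_apply, Finset.sum_apply, smul_eq_mul, div_eq_inv_mul]

/-- **Soundness side**: if every cut of `E` cuts at most `s|E|` edges then `opt(ℑ_E) ≤ s`.
[cite: CharikarMakarychevMakarychev2009, Thm 5.3 proof (p. 11: "every cut cuts at most 1/2 + ε/6 fraction of all edges")] -/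
theorem maxCutInstance_optLE (E : Finset (Sym2 (Fin n))) (hE : E.Nonempty) (hloop : ∀ e ∈ E, ¬ e.IsDiag)
    {s : ℝ} (hs : ∀ x : Fin n → Bool, ∑ e ∈ E, cutFn e x ≤ s * E.card) :
    (maxCutInstance E hE hloop).OptLE s := by
  intro x
  rw [maxCutInstance_val, div_le_iff₀ (by exact_mod_cast card_pos.2 hE)]
  exact hs x

/-- **The gap form consumed downstream (Lemma 2.1 ⇒ Sherali–Adams value):** if every cut of the
edge set `E` cuts at most `s|E|` edges, and a consistent family of local distributions on the sets
of size `≤ d` gives the edges total separation probability `> c|E|`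
(`Σ_e Ẽ[𝟙_{x cuts e}] > c|E|`), then the degree-`d` Sherali–Adams relaxation does not achieve a
`(c,s)`-approximation for MAX-CUT on `n` vertices.
[cite: CharikarMakarychevMakarychev2009, Lemma 2.1 (p. 4–5) and Thm 5.3 (p. 11)]
[cite: KothariMekaRaghavendra2017, Thm 7.4 (p. 20)] -/
theorem not_SAAchieves_maxCut_of_localExpectations (E : Finset (Sym2 (Fin n))) (hE : E.Nonempty)
    (hloop : ∀ e ∈ E, ¬ e.IsDiag) {c s : ℝ}
    (hs : ∀ x : Fin n → Bool, ∑ e ∈ E, cutFn e x ≤ s * E.card)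
    (ℒ : LocalExpectations n d) (hc : c * E.card < ∑ e ∈ E, ℒ.saE (cutFn e)) :
    ¬ SAAchieves (n := n) maxCutPreds d c s := by
  intro h
  have hval := h (maxCutInstance E hE hloop) (maxCutInstance_optLE E hE hloop hs) ℒ.toSA
  rw [LocalExpectations.toSA_E, maxCutInstance_val_eq, map_smul, map_sum, smul_eq_mul] at hval
  have hEpos : (0 : ℝ) < E.card := by exact_mod_cast card_pos.2 hE
  rw [inv_mul_le_iff₀ hEpos] at hval
  linarith

end Literature.Combinatorics.Optimization

end
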